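import Literature.MathematicalPhysics.QuantumLattice.TorusSectorPressureZeroAnchor
import Literature.MathematicalPhysics.QuantumLattice.HubbardTorusMarkovClusterPressureTorusLimit
import Literature.MathematicalPhysics.QuantumLattice.GibbsLogPartitionTemperatureCouplingConvexity
import Literature.MathematicalPhysics.QuantumLattice.HubbardTTPrimePressureFloorUTransport
import Literature.MathematicalPhysics.QuantumLattice.HubbardTTPrimeDiagHopTransportThermal
import Literature.MathematicalPhysics.QuantumLattice.HubbardTTPrimeOpenBoxPartitionFnCouplingTransport
import Literature.MathematicalPhysics.QuantumLattice.TorusSectorGibbsScaleCovariance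
import Mathlib.Topology.Algebra.Order.LiminfLimsup
import HarnessLib

/-!
# The thermal pressure of the 2D `t–t'` Hubbard model as NUMBERS: `limsup` / `liminf` of the canonical
# sector free entropy per site, the certificate dictionary, chords, and joint convexity

Topic `MathematicalPhysics/QuantumLattice` (family `hubbard`; Hubbard material-oracle programme, stage S2 (iii)
`T > 0`, the temperature axis of the phase map `D-0099`). The positive-temperature twin of
`ThermodynamicLimit.energyDensityTT'` (`HubbardNNNHoppingThermodynamicLimit.lean`).

The thermal convention of record is the torus limit of the CANONICAL sector Gibbs states of
`sectorHamiltonianTT' t t' U n L` (`TorusSectorGibbsEnergyWindow.lean`), and every certificate of the `T > 0`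
family (type-class floors `TorusSectorPressureTypeBound*`, Markov / cluster ceilings
`HubbardTorusMarkov*`, EEB windows, the β-staircase `TorusSectorPressureStaircase`) is stated as an EVENTUAL
per-volume bound `∀ ε > 0, ∀ᶠ L, (W − ε) L² ≤ log Z_β^{sector}(L)` (shape `hW`) or
`log Z_β^{sector}(L) ≤ (u + ε) L²` (shape `hu`). This file names the two numbers these shapes bound:

* §0 four `limsup`/`liminf` ⇄ `∀ ε, eventually` lemmas for real sequences (bounded case; Rudin Thm. 3.17);
* §1 `ThermodynamicLimit.sectorPressureTT' β t t' U n L = L⁻² log Re Z_β(sectorHamiltonianTT' t t' U n L)` (finite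
  volume) and **`pressureSupTT' β t t' U n := limsup_L`, `pressureInfTT' β t t' U n := liminf_L`** of it; the
  finite-volume sandwich `−β E₀(L) ≤ log Z ≤ log #sector_L − β E₀(L)` (`E₀(L)` = the `rectN n L`-particle ground
  energy of the torus), eventual boundedness for every `β ≥ 0`, `0 ≤ n < 2` and ALL real `U`
  (`U`-Lipschitz from `U⁺`), `pressureInfTT' ≤ pressureSupTT'`;
* §2 THE DICTIONARY (both directions): `W ≤ pressureInfTT' ↔ ∀ ε > 0, ∀ᶠ L, (W − ε) L² ≤ log Z` and
  `pressureSupTT' ≤ u ↔ ∀ ε > 0, ∀ᶠ L, log Z ≤ (u + ε) L²`, plus the along-`Ls` forms (`hW` / `hu` / `hℓ` shapes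
  the chord, staircase, axis-window and entropy-row theorems consume) — so every pressure certificate deposits a
  ROW KEYED TO A DEFINED CONSTANT and every eventual-form reader stays callable from such rows;
* §3 the a-priori window `−β e(t,t',U,n) ≤ pressureInfTT' ≤ pressureSupTT' ≤ 2 H_b(n/2) − β e(t,t',U,n)` (`U ≥ 0`) and
  the exact infinite-temperature value `pressureInfTT' 0 = pressureSupTT' 0 = 2 H_b(n/2)`;
* §4 THERMAL ENERGY WINDOWS of every torus-limit Gibbs state `ω` at `β` as chords of the numbers:
  `e_Φ(ω) ≤ (pressureSupTT' β_h − pressureInfTT' β)/(β − β_h)` (`0 < β_h < β`),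
  `(pressureInfTT' β − pressureSupTT' β_c)/(β_c − β) ≤ e_Φ(ω)` (`β < β_c`), `e_Φ(ω) ≤ (2H_b(n/2) − pressureInfTT' β)/β`;
  and the β-staircase back: a cap (floor) on EVERY torus limit at `b₀` (`b₁`) moves `pressureInfTT'`
  (`pressureSupTT'`) from `b₀` to `b₁ ≥ b₀` with slope `−e`;
* §5 scale covariance `p(β; ct, ct', cU) = p(βc; t, t', U)`, **JOINT CONVEXITY of `pressureSupTT'` in the
  β-scaled couplings** `(βt, βt', βU)` (`limsup` of convex functions) with the Jensen CAP over TEMPERATURE ×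
  COUPLING cells (corner ceilings ⇒ ceiling at every barycentre), convexity in `β` at fixed couplings,
  antitonicity in `U`, and the kinematic Lipschitz constants `4βn` (`t'`) and `βn/2` (`U`) for both numbers.

Existence of the limit (`pressureInfTT' = pressureSupTT'`), particle–hole and the other lattice symmetries
(which hold torus by torus only on even tori) and the grand-canonical Legendre link are NOT here (sequel files).
No named fact; two real definitions + one finite-volume abbreviation-style definition.

## Mathlib / tree search

`lean search 'pressureSup|pressureInf|limsup.*partitionFn'`: nothing for the Hubbard sector (2026-08-27); the
only TL "pressure" objects are the eventual shapes above. REUSED: `Filter.le_liminf_of_le`, `Filter.limsup_le_of_le`,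
`Filter.eventually_lt_of_lt_liminf`, `Filter.eventually_lt_of_limsup_lt`, `Filter.liminf_le_limsup`,
`IsBoundedUnder.isCoboundedUnder_le/ge` (Mathlib); `partitionFn_sectorHamiltonianTT'_re`,
`re_expect_sectorGibbsVectorTT'`, `isNParticle_sectorGibbsVectorTT'`, `nonempty_szConfig`,
`sectorGibbs_meanEnergy_le_chord`-family readers `IsTorusLimitOfMixture.meanEnergy_hubbardTTPrime_le_chord_of_sectorGibbs`
/ `chord_le_…` / `…le_entropy_sub_div…` (`TorusSectorGibbsEnergyWindow`), `eventually_pressureFloor_staircase`,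
`eventually_pressureCeiling_staircase` (`TorusSectorPressureStaircase`), `eventually_le_log_sectorGibbsCount`,
`eventually_log_sectorGibbsCount_le`, `partitionFn_zero_re` (`TorusSectorPressureZeroAnchor`, `TorusSectorGibbsMixture`),
`eventually_neg_mul_le_log_partitionFn_sectorHamiltonianTT'`, `groundEnergy_sectorHamiltonianTT'_le`
(`HubbardTorusMarkovClusterPressureTorusLimit`), `tendsto_energyDensityTT'_torus`,
`log_partitionFn_sectorHamiltonianTT'_le_sum_temperature` (`GibbsLogPartitionTemperatureCouplingConvexity`),
`abs_log_partitionFn_sectorHamiltonianTT'_sub_le_U` (`HubbardTTPrimePressureFloorUTransport`),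
`abs_log_partitionFn_sector_sub_le_tPrime` (`HubbardTTPrimeDiagHopTransportThermal`),
`log_partitionFn_sectorHamiltonianTT'_anti_U` (`HubbardTTPrimeOpenBoxPartitionFnCouplingTransport`),
`partitionFn_sectorHamiltonianTT'_scale` (`TorusSectorGibbsScaleCovariance`), `tendsto_rectN_div_sq`.

## References

* R. B. Israel, *Convexity in the Theory of Lattice Gases* (1979), Thm. I.2.3–I.2.4 (pressure: existence, convexity),
  Lemma II.3.1 (variational principle / chords). [cite: Israel1979, Thm. I.2.4]
* D. Ruelle, *Statistical Mechanics: Rigorous Results* (1969), §2.5–2.6, §3.3–3.4. [cite: Ruelle1969, §2.5–2.6]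
* B. Simon, *The Statistical Mechanics of Lattice Gases* I (1993), §II.2–II.3. [cite: Simon1993, §II.3]
* S. J. Gustafson, I. M. Sigal, *Mathematical Concepts of Quantum Mechanics* (2011), §18.3 (`β ↦ log Z_β` convex).
  [cite: GustafsonSigal2003, §18.3]
-/

noncomputable section

namespace Literature.MathematicalPhysics.QuantumLattice

open Matrix Finset HubbardWave0 Literature.Probability.LatticeModels
open _root_.Filter
open scoped _root_.Topology ComplexOrder BigOperators

namespace ThermodynamicLimit

/-! ### §0 Real sequences: `liminf` / `limsup` versus `∀ ε > 0, eventually` -/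

/-- **`W ≤ liminf u` from `∀ ε > 0`, eventually `W − ε ≤ u_L`** (for a sequence eventually bounded above;
Rudin's characterisation of the lower limit). [cite: Rudin1976, Thm. 3.17] -/
theorem le_liminf_of_forall_eventually_sub_le {u : ℕ → ℝ} {C W : ℝ} (hC : ∀ᶠ L in atTop, u L ≤ C)
    (h : ∀ ε : ℝ, 0 < ε → ∀ᶠ L in atTop, W - ε ≤ u L) : W ≤ liminf u atTop :=
  le_of_forall_sub_le fun ε hε =>
    le_liminf_of_le (isBoundedUnder_of_eventually_le hC).isCoboundedUnder_ge (h ε hε)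

/-- **`W ≤ liminf u` gives `∀ ε > 0`, eventually `W − ε < u_L`** (for a sequence eventually bounded below).
[cite: Rudin1976, Thm. 3.17] -/
theorem eventually_sub_lt_of_le_liminf {u : ℕ → ℝ} {c W : ℝ} (hc : ∀ᶠ L in atTop, c ≤ u L)
    (h : W ≤ liminf u atTop) {ε : ℝ} (hε : 0 < ε) : ∀ᶠ L in atTop, W - ε < u L :=
  eventually_lt_of_lt_liminf (lt_of_lt_of_le (sub_lt_self W hε) h) (isBoundedUnder_of_eventually_ge hc)

/-- **`limsup u ≤ a` from `∀ ε > 0`, eventually `u_L ≤ a + ε`** (for a sequence eventually bounded below).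
[cite: Rudin1976, Thm. 3.17] -/
theorem limsup_le_of_forall_eventually_le_add {u : ℕ → ℝ} {c a : ℝ} (hc : ∀ᶠ L in atTop, c ≤ u L)
    (h : ∀ ε : ℝ, 0 < ε → ∀ᶠ L in atTop, u L ≤ a + ε) : limsup u atTop ≤ a :=
  le_of_forall_pos_le_add fun ε hε =>
    limsup_le_of_le (isBoundedUnder_of_eventually_ge hc).isCoboundedUnder_le (h ε hε)

/-- **`limsup u ≤ a` gives `∀ ε > 0`, eventually `u_L < a + ε`** (for a sequence eventually bounded above).
[cite: Rudin1976, Thm. 3.17] -/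
theorem eventually_lt_add_of_limsup_le {u : ℕ → ℝ} {C a : ℝ} (hC : ∀ᶠ L in atTop, u L ≤ C)
    (h : limsup u atTop ≤ a) {ε : ℝ} (hε : 0 < ε) : ∀ᶠ L in atTop, u L < a + ε :=
  eventually_lt_of_limsup_lt (lt_of_le_of_lt h (lt_add_of_pos_right a hε)) (isBoundedUnder_of_eventually_le hC)

/-! ### §1 The finite-volume canonical pressure and its `limsup` / `liminf` -/

/-- **The finite-volume canonical pressure** (free entropy per site) of the `t–t'` Hubbard torus `L × L` in the
sector `(N, S^z) = (rectN n L, 0)`: `p_L(β; t,t',U; n) = L⁻² · log Re Z_β(sectorHamiltonianTT' t t' U n L)`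
(`= −β f_L`, `f_L` the canonical free energy per site). [cite: Israel1979, Lemma II.3.1] -/
def sectorPressureTT' (β t t' U n : ℝ) (L : ℕ) : ℝ :=
  Real.log (partitionFn β (sectorHamiltonianTT' t t' U n L)).re / (L : ℝ) ^ 2

/-- **The upper thermal pressure** of the 2D `t–t'` Hubbard model at inverse temperature `β`, couplings
`(t,t',U)` and filling `n`: `p⁺(β; t,t',U; n) := limsup_{L → ∞} p_L`. Every certified eventual per-volume CEILING
`log Z_β^{sector}(L) ≤ (u + ε) L²` is exactly a bound `p⁺ ≤ u` (§2). [cite: Israel1979, Thm. I.2.4] -/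
def pressureSupTT' (β t t' U n : ℝ) : ℝ :=
  limsup (fun L : ℕ => sectorPressureTT' β t t' U n L) atTop

/-- **The lower thermal pressure** of the 2D `t–t'` Hubbard model: `p⁻(β; t,t',U; n) := liminf_{L → ∞} p_L`.
Every certified eventual per-volume FLOOR `(W − ε) L² ≤ log Z_β^{sector}(L)` (type-class / trial-state
certificates, the β-staircase) is exactly a bound `W ≤ p⁻` (§2). [cite: Israel1979, Thm. I.2.4] -/
def pressureInfTT' (β t t' U n : ℝ) : ℝ :=
  liminf (fun L : ℕ => sectorPressureTT' β t t' U n L) atTop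

/-- Unfolding: `p_L · L² = log Re Z` for `L ≥ 1`. [cite: Israel1979, Lemma II.3.1] -/
theorem sectorPressureTT'_mul_sq (β t t' U n : ℝ) {L : ℕ} (hL : 1 ≤ L) :
    sectorPressureTT' β t t' U n L * (L : ℝ) ^ 2 = Real.log (partitionFn β (sectorHamiltonianTT' t t' U n L)).re := by
  have hL2 : (0 : ℝ) < (L : ℝ) ^ 2 := by
    have : (1 : ℝ) ≤ L := by exact_mod_cast hL
    positivity
  rw [sectorPressureTT', div_mul_cancel₀ _ hL2.ne']

/-- **Finite-volume floor** `−β · E₀(L) ≤ log Re Z_β^{sector}(L)` (`β ≥ 0`, `0 ≤ n ≤ 2`, `L ≥ 1`), `E₀(L)` the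
`rectN n L`-particle ground energy of `hubbardTorusTT' L t t' U`: the sector ground energy is at most `E₀(L)`
(`groundEnergy_sectorHamiltonianTT'_le`) and `Z ≥ e^{−β E_min}`. [cite: Ruelle1969, §2.5–2.6] -/
theorem neg_mul_groundEnergy_le_log_partitionFn_sector {β : ℝ} (hβ : 0 ≤ β) (t t' U : ℝ) {n : ℝ} (hn0 : 0 ≤ n)
    (hn2 : n ≤ 2) (L : ℕ) [NeZero L] :
    -(β * groundEnergy (hubbardTorusTT' L t t' U) (rectN n L)) ≤
      Real.log (partitionFn β (sectorHamiltonianTT' t t' U n L)).re := by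
  haveI := nonempty_szConfig hn0 hn2 L
  have h1 := (isHermitian_sectorHamiltonianTT' t t' U n L).neg_log_partitionFn_le_mul_groundEnergy β
  have h2 := groundEnergy_sectorHamiltonianTT'_le t t' U hn0 hn2 L
  have h3 : β * (sectorHamiltonianTT' t t' U n L).groundEnergy ≤
      β * groundEnergy (hubbardTorusTT' L t t' U) (rectN n L) := mul_le_mul_of_nonneg_left h2 hβ
  linarith

/-- **Finite-volume ceiling** `log Re Z_β^{sector}(L) ≤ log #sector_L − β · E₀(L)` (`β ≥ 0`, `0 ≤ n ≤ 2`): every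
sector eigenvector is a unit `rectN n L`-particle vector, so its energy is at least `E₀(L)` and
`Z = Σ_i e^{−βE_i} ≤ #sector · e^{−βE₀(L)}`. [cite: Ruelle1969, §2.5–2.6] -/
theorem log_partitionFn_sector_le_log_count_sub {β : ℝ} (hβ : 0 ≤ β) (t t' U : ℝ) {n : ℝ} (hn0 : 0 ≤ n)
    (hn2 : n ≤ 2) (L : ℕ) :
    Real.log (partitionFn β (sectorHamiltonianTT' t t' U n L)).re ≤
      Real.log (sectorGibbsCount n L) - β * groundEnergy (hubbardTorusTT' L t t' U) (rectN n L) := by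
  set E₀ := groundEnergy (hubbardTorusTT' L t t' U) (rectN n L) with hE₀
  haveI : Nonempty (Subtype (szConfig n L)) := nonempty_szConfig hn0 hn2 L
  have hcount : 0 < sectorGibbsCount n L := by
    obtain ⟨s, hs⟩ := exists_szConfig hn0 hn2 L
    exact Fintype.card_pos_iff.2 ⟨⟨s, hs⟩⟩
  have hterm : ∀ i : Fin (sectorGibbsCount n L),
      Real.exp (-(β * sectorGibbsEnergyTT' t t' U n L i)) ≤ Real.exp (-(β * E₀)) := by
    intro i
    have hE : E₀ ≤ sectorGibbsEnergyTT' t t' U n L i := by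
      rw [← re_expect_sectorGibbsVectorTT']
      exact LiebThm1.groundEnergy_le_re_expect _ (isNParticle_sectorGibbsVectorTT' t t' U n L i)
        (star_sectorGibbsVectorTT'_dotProduct_self t t' U n L i)
    exact Real.exp_le_exp.2 (neg_le_neg (mul_le_mul_of_nonneg_left hE hβ))
  have hsum : (partitionFn β (sectorHamiltonianTT' t t' U n L)).re ≤
      (sectorGibbsCount n L : ℝ) * Real.exp (-(β * E₀)) := by
    rw [partitionFn_sectorHamiltonianTT'_re]
    calc ∑ i, Real.exp (-(β * sectorGibbsEnergyTT' t t' U n L i))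
        ≤ ∑ _i : Fin (sectorGibbsCount n L), Real.exp (-(β * E₀)) := Finset.sum_le_sum fun i _ => hterm i
      _ = (sectorGibbsCount n L : ℝ) * Real.exp (-(β * E₀)) := by
          rw [Finset.sum_const, Finset.card_univ, Fintype.card_fin, nsmul_eq_mul]
  have hZ : 0 < (partitionFn β (sectorHamiltonianTT' t t' U n L)).re :=
    partitionFn_re_pos (isHermitian_sectorHamiltonianTT' t t' U n L) β
  calc Real.log (partitionFn β (sectorHamiltonianTT' t t' U n L)).re
      ≤ Real.log ((sectorGibbsCount n L : ℝ) * Real.exp (-(β * E₀))) := Real.log_le_log hZ hsum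
    _ = Real.log (sectorGibbsCount n L) - β * E₀ := by
        rw [Real.log_mul (by exact_mod_cast hcount.ne') (Real.exp_pos _).ne', Real.log_exp]; ring

/-- **Eventual lower bound** (`β ≥ 0`, `U ≥ 0`, `0 ≤ n < 2`): `∀ ε > 0`, eventually
`−β e(t,t',U,n) − ε ≤ p_L` (the ground-state anchor `log Z ≥ −β E₀(L)` with `E₀(L)/L² → e`).
[cite: Ruelle1969, §3.3] -/
theorem eventually_neg_mul_energyDensityTT'_sub_le_sectorPressureTT' {β : ℝ} (hβ : 0 ≤ β) (t t' : ℝ) {U : ℝ}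
    (hU : 0 ≤ U) {n : ℝ} (hn0 : 0 ≤ n) (hn2 : n < 2) {ε : ℝ} (hε : 0 < ε) :
    ∀ᶠ L : ℕ in atTop, -(β * energyDensityTT' t t' U n) - ε ≤ sectorPressureTT' β t t' U n L := by
  have hε' : 0 < ε / (β + 1) := div_pos hε (by linarith)
  have h := eventually_neg_mul_le_log_partitionFn_sectorHamiltonianTT' t t' hU hn0 hn2 hβ tendsto_id hε'
  filter_upwards [h, eventually_ge_atTop 1] with L hL hL1
  have hL2 : (0 : ℝ) < (L : ℝ) ^ 2 := by
    have : (1 : ℝ) ≤ L := by exact_mod_cast hL1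
    positivity
  rw [sectorPressureTT', le_div_iff₀ hL2]
  simp only [id] at hL
  have hb : β * (ε / (β + 1)) ≤ ε := by
    rw [mul_div_assoc']
    exact (div_le_iff₀ (by linarith)).2 (by nlinarith)
  have hb2 := mul_le_mul_of_nonneg_right hb hL2.le
  have key : (-(β * energyDensityTT' t t' U n) - ε) * (L : ℝ) ^ 2 ≤
      -(β * (energyDensityTT' t t' U n + ε / (β + 1))) * (L : ℝ) ^ 2 := by
    have e1 : (-(β * energyDensityTT' t t' U n) - ε) * (L : ℝ) ^ 2 =
        -(β * (energyDensityTT' t t' U n + ε / (β + 1))) * (L : ℝ) ^ 2 -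
          (ε * (L : ℝ) ^ 2 - β * (ε / (β + 1)) * (L : ℝ) ^ 2) := by ring
    rw [e1]
    linarith [hb2]
  exact key.trans hL

/-- **Eventual upper bound** (`β ≥ 0`, `U ≥ 0`, `0 ≤ n < 2`): `∀ ε > 0`, eventually
`p_L ≤ 2 H_b(n/2) − β e(t,t',U,n) + ε` (`log #sector_L ≤ (2H_b(n/2) + ε/2) L²` eventually and
`β E₀(L)/L² → β e`). [cite: Ruelle1969, §3.3] -/
theorem eventually_sectorPressureTT'_le_binEntropy_sub_add {β : ℝ} (hβ : 0 ≤ β) (t t' : ℝ) {U : ℝ} (hU : 0 ≤ U)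
    {n : ℝ} (hn0 : 0 ≤ n) (hn2 : n < 2) {ε : ℝ} (hε : 0 < ε) :
    ∀ᶠ L : ℕ in atTop, sectorPressureTT' β t t' U n L ≤
      2 * Real.binEntropy (n / 2) - β * energyDensityTT' t t' U n + ε := by
  have hcount := eventually_log_sectorGibbsCount_le hn0 hn2.le (s := 2 * Real.binEntropy (n / 2) + ε / 2)
    (by linarith)
  have hT := ((tendsto_energyDensityTT'_torus t t' hU hn0 hn2).const_mul β)
  have hev : ∀ᶠ L : ℕ in atTop, β * energyDensityTT' t t' U n - ε / 2 <
      β * (groundEnergy (hubbardTorusTT' L t t' U) (rectN n L) / (L : ℝ) ^ 2) :=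
    hT.eventually (Ioi_mem_nhds (by linarith))
  filter_upwards [hcount, hev, eventually_ge_atTop 1] with L hc he hL1
  haveI : NeZero L := ⟨by omega⟩
  have hL2 : (0 : ℝ) < (L : ℝ) ^ 2 := by
    have : (1 : ℝ) ≤ L := by exact_mod_cast hL1
    positivity
  have hfin := log_partitionFn_sector_le_log_count_sub hβ t t' U hn0 hn2.le L
  rw [sectorPressureTT', div_le_iff₀ hL2]
  have he' : (β * energyDensityTT' t t' U n - ε / 2) * (L : ℝ) ^ 2 <
      β * groundEnergy (hubbardTorusTT' L t t' U) (rectN n L) := by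
    rw [← mul_div_assoc] at he
    exact (lt_div_iff₀ hL2).1 he
  linarith

/-- **Eventual two-sided boundedness for EVERY real `U`** (`β ≥ 0`, `0 ≤ n < 2`): there are `c ≤ C` with
eventually `c ≤ p_L ≤ C` — the `U ≥ 0` window transported from `U⁺ = max U 0` by the `U`-Lipschitz bound
`|log Z(U₁) − log Z(U₂)| ≤ β (n/2) L² |U₁ − U₂|`. [cite: Israel1979, Thm. I.2.4] -/
theorem eventually_abs_sectorPressureTT'_le {β : ℝ} (hβ : 0 ≤ β) (t t' U : ℝ) {n : ℝ} (hn0 : 0 ≤ n)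
    (hn2 : n < 2) : ∃ C : ℝ, ∀ᶠ L : ℕ in atTop, |sectorPressureTT' β t t' U n L| ≤ C := by
  set U₀ := max U 0 with hU₀
  have hU₀0 : 0 ≤ U₀ := le_max_right _ _
  set e := energyDensityTT' t t' U₀ n
  refine ⟨max (|-(β * e) - 1|) (|2 * Real.binEntropy (n / 2) - β * e + 1|) + β * (n / 2) * |U - U₀|, ?_⟩
  filter_upwards [eventually_neg_mul_energyDensityTT'_sub_le_sectorPressureTT' hβ t t' hU₀0 hn0 hn2 one_pos,
    eventually_sectorPressureTT'_le_binEntropy_sub_add hβ t t' hU₀0 hn0 hn2 one_pos, eventually_ge_atTop 1]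
    with L hlo hhi hL1
  haveI : NeZero L := ⟨by omega⟩
  have hL2 : (0 : ℝ) < (L : ℝ) ^ 2 := by
    have : (1 : ℝ) ≤ L := by exact_mod_cast hL1
    positivity
  have hlip := abs_log_partitionFn_sectorHamiltonianTT'_sub_le_U hn0 hn2.le L t t' hβ U U₀
  have hlip' : |sectorPressureTT' β t t' U n L - sectorPressureTT' β t t' U₀ n L| ≤ β * (n / 2) * |U - U₀| := by
    rw [sectorPressureTT', sectorPressureTT', ← sub_div, abs_div, abs_of_pos hL2, div_le_iff₀ hL2]
    calc _ ≤ β * (n / 2 * (L : ℝ) ^ 2) * |U - U₀| := hlip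
      _ = β * (n / 2) * |U - U₀| * (L : ℝ) ^ 2 := by ring
  have h0 : |sectorPressureTT' β t t' U₀ n L| ≤ max (|-(β * e) - 1|) (|2 * Real.binEntropy (n / 2) - β * e + 1|) :=
    abs_le_max_abs_abs hlo hhi
  calc |sectorPressureTT' β t t' U n L|
      = |sectorPressureTT' β t t' U₀ n L + (sectorPressureTT' β t t' U n L - sectorPressureTT' β t t' U₀ n L)| := by
        ring_nf
    _ ≤ |sectorPressureTT' β t t' U₀ n L| + |sectorPressureTT' β t t' U n L - sectorPressureTT' β t t' U₀ n L| :=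
        abs_add_le _ _
    _ ≤ _ := add_le_add h0 hlip'

/-- Eventual upper bound (existential form, every real `U`). [cite: Israel1979, Thm. I.2.4] -/
theorem exists_eventually_sectorPressureTT'_le {β : ℝ} (hβ : 0 ≤ β) (t t' U : ℝ) {n : ℝ} (hn0 : 0 ≤ n)
    (hn2 : n < 2) : ∃ C : ℝ, ∀ᶠ L : ℕ in atTop, sectorPressureTT' β t t' U n L ≤ C := by
  obtain ⟨C, hC⟩ := eventually_abs_sectorPressureTT'_le hβ t t' U hn0 hn2
  exact ⟨C, hC.mono fun L h => (abs_le.1 h).2⟩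

/-- Eventual lower bound (existential form, every real `U`). [cite: Israel1979, Thm. I.2.4] -/
theorem exists_eventually_le_sectorPressureTT' {β : ℝ} (hβ : 0 ≤ β) (t t' U : ℝ) {n : ℝ} (hn0 : 0 ≤ n)
    (hn2 : n < 2) : ∃ c : ℝ, ∀ᶠ L : ℕ in atTop, c ≤ sectorPressureTT' β t t' U n L := by
  obtain ⟨C, hC⟩ := eventually_abs_sectorPressureTT'_le hβ t t' U hn0 hn2
  exact ⟨-C, hC.mono fun L h => (abs_le.1 h).1⟩

/-- The finite-volume pressures are bounded above along `L → ∞` (`Filter.IsBoundedUnder`).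
[cite: Israel1979, Thm. I.2.4] -/
theorem isBoundedUnder_le_sectorPressureTT' {β : ℝ} (hβ : 0 ≤ β) (t t' U : ℝ) {n : ℝ} (hn0 : 0 ≤ n)
    (hn2 : n < 2) : IsBoundedUnder (· ≤ ·) atTop (fun L : ℕ => sectorPressureTT' β t t' U n L) := by
  obtain ⟨C, hC⟩ := exists_eventually_sectorPressureTT'_le hβ t t' U hn0 hn2
  exact isBoundedUnder_of_eventually_le hC

/-- The finite-volume pressures are bounded below along `L → ∞`. [cite: Israel1979, Thm. I.2.4] -/
theorem isBoundedUnder_ge_sectorPressureTT' {β : ℝ} (hβ : 0 ≤ β) (t t' U : ℝ) {n : ℝ} (hn0 : 0 ≤ n)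
    (hn2 : n < 2) : IsBoundedUnder (· ≥ ·) atTop (fun L : ℕ => sectorPressureTT' β t t' U n L) := by
  obtain ⟨c, hc⟩ := exists_eventually_le_sectorPressureTT' hβ t t' U hn0 hn2
  exact isBoundedUnder_of_eventually_ge hc

/-- **`p⁻ ≤ p⁺`** (`β ≥ 0`, `0 ≤ n < 2`, every `t, t', U`). [cite: Israel1979, Thm. I.2.4] -/
theorem pressureInfTT'_le_pressureSupTT' {β : ℝ} (hβ : 0 ≤ β) (t t' U : ℝ) {n : ℝ} (hn0 : 0 ≤ n)
    (hn2 : n < 2) : pressureInfTT' β t t' U n ≤ pressureSupTT' β t t' U n :=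
  liminf_le_limsup (isBoundedUnder_le_sectorPressureTT' hβ t t' U hn0 hn2)
    (isBoundedUnder_ge_sectorPressureTT' hβ t t' U hn0 hn2)

/-! ### §2 The dictionary with the certificate shapes of record -/

/-- **Pressure FLOORS are bounds on `p⁻`**: `W ≤ p⁻(β; t,t',U; n)` iff for every `ε > 0`, eventually in `L`,
`(W − ε) L² ≤ log Re Z_β(sectorHamiltonianTT' t t' U n L)` — the `hW` shape of the type-class certificates and
of the β-staircase (`β ≥ 0`, `0 ≤ n < 2`). [cite: Israel1979, Thm. I.2.4] -/
theorem le_pressureInfTT'_iff {β : ℝ} (hβ : 0 ≤ β) (t t' U : ℝ) {n : ℝ} (hn0 : 0 ≤ n) (hn2 : n < 2) {W : ℝ} :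
    W ≤ pressureInfTT' β t t' U n ↔ ∀ ε : ℝ, 0 < ε → ∀ᶠ L : ℕ in atTop,
      (W - ε) * (L : ℝ) ^ 2 ≤ Real.log (partitionFn β (sectorHamiltonianTT' t t' U n L)).re := by
  obtain ⟨c, hc⟩ := exists_eventually_le_sectorPressureTT' hβ t t' U hn0 hn2
  obtain ⟨C, hC⟩ := exists_eventually_sectorPressureTT'_le hβ t t' U hn0 hn2
  constructor
  · intro h ε hε
    filter_upwards [eventually_sub_lt_of_le_liminf hc h hε, eventually_ge_atTop 1] with L hL hL1
    rw [← sectorPressureTT'_mul_sq β t t' U n hL1]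
    exact mul_le_mul_of_nonneg_right hL.le (sq_nonneg _)
  · intro h
    refine le_liminf_of_forall_eventually_sub_le hC fun ε hε => ?_
    filter_upwards [h ε hε, eventually_ge_atTop 1] with L hL hL1
    have hL2 : (0 : ℝ) < (L : ℝ) ^ 2 := by
      have : (1 : ℝ) ≤ L := by exact_mod_cast hL1
      positivity
    rw [sectorPressureTT', le_div_iff₀ hL2]
    exact hL

/-- **Pressure CEILINGS are bounds on `p⁺`**: `p⁺(β; t,t',U; n) ≤ u` iff for every `ε > 0`, eventually in `L`,
`log Re Z_β(sectorHamiltonianTT' t t' U n L) ≤ (u + ε) L²` — the `hu` shape of the Markov / cluster and EEB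
ceilings (`β ≥ 0`, `0 ≤ n < 2`). [cite: Israel1979, Thm. I.2.4] -/
theorem pressureSupTT'_le_iff {β : ℝ} (hβ : 0 ≤ β) (t t' U : ℝ) {n : ℝ} (hn0 : 0 ≤ n) (hn2 : n < 2) {u : ℝ} :
    pressureSupTT' β t t' U n ≤ u ↔ ∀ ε : ℝ, 0 < ε → ∀ᶠ L : ℕ in atTop,
      Real.log (partitionFn β (sectorHamiltonianTT' t t' U n L)).re ≤ (u + ε) * (L : ℝ) ^ 2 := by
  obtain ⟨c, hc⟩ := exists_eventually_le_sectorPressureTT' hβ t t' U hn0 hn2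
  obtain ⟨C, hC⟩ := exists_eventually_sectorPressureTT'_le hβ t t' U hn0 hn2
  constructor
  · intro h ε hε
    filter_upwards [eventually_lt_add_of_limsup_le hC h hε, eventually_ge_atTop 1] with L hL hL1
    rw [← sectorPressureTT'_mul_sq β t t' U n hL1]
    exact mul_le_mul_of_nonneg_right hL.le (sq_nonneg _)
  · intro h
    refine limsup_le_of_forall_eventually_le_add hc fun ε hε => ?_
    filter_upwards [h ε hε, eventually_ge_atTop 1] with L hL hL1
    have hL2 : (0 : ℝ) < (L : ℝ) ^ 2 := by
      have : (1 : ℝ) ≤ L := by exact_mod_cast hL1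
      positivity
    rw [sectorPressureTT', div_le_iff₀ hL2]
    exact hL

/-- A plain eventual floor `W L² ≤ log Z` (no `ε`) bounds `p⁻` from below. [cite: Israel1979, Thm. I.2.4] -/
theorem le_pressureInfTT'_of_eventually_le {β : ℝ} (hβ : 0 ≤ β) (t t' U : ℝ) {n : ℝ} (hn0 : 0 ≤ n)
    (hn2 : n < 2) {W : ℝ}
    (h : ∀ᶠ L : ℕ in atTop, W * (L : ℝ) ^ 2 ≤ Real.log (partitionFn β (sectorHamiltonianTT' t t' U n L)).re) :
    W ≤ pressureInfTT' β t t' U n :=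
  (le_pressureInfTT'_iff hβ t t' U hn0 hn2).2 fun _ hε =>
    h.mono fun _ hL => le_trans (mul_le_mul_of_nonneg_right (sub_le_self W hε.le) (sq_nonneg _)) hL

/-- A plain eventual ceiling `log Z ≤ u L²` (no `ε`) bounds `p⁺` from above. [cite: Israel1979, Thm. I.2.4] -/
theorem pressureSupTT'_le_of_eventually_le {β : ℝ} (hβ : 0 ≤ β) (t t' U : ℝ) {n : ℝ} (hn0 : 0 ≤ n)
    (hn2 : n < 2) {u : ℝ}
    (h : ∀ᶠ L : ℕ in atTop, Real.log (partitionFn β (sectorHamiltonianTT' t t' U n L)).re ≤ u * (L : ℝ) ^ 2) :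
    pressureSupTT' β t t' U n ≤ u :=
  (pressureSupTT'_le_iff hβ t t' U hn0 hn2).2 fun _ hε =>
    h.mono fun _ hL => hL.trans (mul_le_mul_of_nonneg_right (le_add_of_nonneg_right hε.le) (sq_nonneg _))

/-- **The `hW` shape along any side sequence**: `W ≤ p⁻` gives, for every `Ls → ∞` and every `ε > 0`, eventually
`(W − ε) (Ls j)² ≤ log Re Z_β(sectorHamiltonianTT' t t' U n (Ls j))` — the pressure-floor INPUT of
`HubbardThermalAxisWindow`, `TorusSectorPressureStaircase`, `TorusSectorGibbsEntropyRowPressureInput`.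
[cite: Israel1979, Thm. I.2.4] -/
theorem eventually_sub_mul_sq_le_log_partitionFn_of_le_pressureInfTT' {β : ℝ} (hβ : 0 ≤ β) (t t' U : ℝ)
    {n : ℝ} (hn0 : 0 ≤ n) (hn2 : n < 2) {W : ℝ} (hW : W ≤ pressureInfTT' β t t' U n) {Ls : ℕ → ℕ}
    (hLs : Tendsto Ls atTop atTop) {ε : ℝ} (hε : 0 < ε) :
    ∀ᶠ j in atTop, (W - ε) * (Ls j : ℝ) ^ 2 ≤ Real.log (partitionFn β (sectorHamiltonianTT' t t' U n (Ls j))).re :=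
  hLs.eventually ((le_pressureInfTT'_iff hβ t t' U hn0 hn2).1 hW ε hε)

/-- **The `hu` shape along any side sequence**: `p⁺ ≤ u` gives, for every `Ls → ∞` and every `ε > 0`, eventually
`log Re Z_β(sectorHamiltonianTT' t t' U n (Ls j)) ≤ (u + ε) (Ls j)²` — the pressure-ceiling INPUT (hot / cold
anchors) of the chord theorems. [cite: Israel1979, Thm. I.2.4] -/
theorem eventually_log_partitionFn_le_add_mul_sq_of_pressureSupTT'_le {β : ℝ} (hβ : 0 ≤ β) (t t' U : ℝ)
    {n : ℝ} (hn0 : 0 ≤ n) (hn2 : n < 2) {u : ℝ} (hu : pressureSupTT' β t t' U n ≤ u) {Ls : ℕ → ℕ}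
    (hLs : Tendsto Ls atTop atTop) {ε : ℝ} (hε : 0 < ε) :
    ∀ᶠ j in atTop, Real.log (partitionFn β (sectorHamiltonianTT' t t' U n (Ls j))).re ≤ (u + ε) * (Ls j : ℝ) ^ 2 :=
  hLs.eventually ((pressureSupTT'_le_iff hβ t t' U hn0 hn2).1 hu ε hε)

/-! ### §3 The a-priori window and the infinite-temperature value -/

/-- **Ground-state anchor**: `−β · e(t,t',U,n) ≤ p⁻(β; t,t',U; n)` (`β ≥ 0`, `U ≥ 0`, `0 ≤ n < 2`).
[cite: Ruelle1969, §3.3] -/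
theorem neg_mul_energyDensityTT'_le_pressureInfTT' {β : ℝ} (hβ : 0 ≤ β) (t t' : ℝ) {U : ℝ} (hU : 0 ≤ U)
    {n : ℝ} (hn0 : 0 ≤ n) (hn2 : n < 2) : -(β * energyDensityTT' t t' U n) ≤ pressureInfTT' β t t' U n := by
  obtain ⟨C, hC⟩ := exists_eventually_sectorPressureTT'_le hβ t t' U hn0 hn2
  exact le_liminf_of_forall_eventually_sub_le hC fun ε hε =>
    eventually_neg_mul_energyDensityTT'_sub_le_sectorPressureTT' hβ t t' hU hn0 hn2 hε

/-- **Entropy anchor**: `p⁺(β; t,t',U; n) ≤ 2 H_b(n/2) − β · e(t,t',U,n)` (`β ≥ 0`, `U ≥ 0`, `0 ≤ n < 2`) — with the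
ground-state anchor: `p(β)/β → −e` as `β → ∞` at rate `2H_b(n/2)/β`. [cite: Ruelle1969, §3.3] -/
theorem pressureSupTT'_le_two_mul_binEntropy_sub {β : ℝ} (hβ : 0 ≤ β) (t t' : ℝ) {U : ℝ} (hU : 0 ≤ U) {n : ℝ}
    (hn0 : 0 ≤ n) (hn2 : n < 2) :
    pressureSupTT' β t t' U n ≤ 2 * Real.binEntropy (n / 2) - β * energyDensityTT' t t' U n := by
  obtain ⟨c, hc⟩ := exists_eventually_le_sectorPressureTT' hβ t t' U hn0 hn2
  exact limsup_le_of_forall_eventually_le_add hc fun ε hε =>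
    eventually_sectorPressureTT'_le_binEntropy_sub_add hβ t t' hU hn0 hn2 hε

/-- At `β = 0` the finite-volume pressure is the entropy density `L⁻² log #sector_L` (every `t, t', U`).
[cite: Israel1979, Lemma II.3.1] -/
theorem sectorPressureTT'_zero (t t' U n : ℝ) (L : ℕ) :
    sectorPressureTT' 0 t t' U n L = Real.log (sectorGibbsCount n L) / (L : ℝ) ^ 2 := by
  rw [sectorPressureTT', partitionFn_zero_re]
  rfl

/-- **The infinite-temperature value, upper half**: `p⁺(0; t,t',U; n) = 2 H_b(n/2)` (`0 ≤ n ≤ 2`; binary entropy of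
the two spin species at density `n/2` each). [cite: Israel1979, Lemma II.3.1] -/
theorem pressureSupTT'_zero (t t' U : ℝ) {n : ℝ} (hn0 : 0 ≤ n) (hn2 : n ≤ 2) :
    pressureSupTT' 0 t t' U n = 2 * Real.binEntropy (n / 2) := by
  have hup : ∀ s : ℝ, 2 * Real.binEntropy (n / 2) < s → ∀ᶠ L : ℕ in atTop, sectorPressureTT' 0 t t' U n L ≤ s := by
    intro s hs
    filter_upwards [eventually_log_sectorGibbsCount_le hn0 hn2 hs, eventually_ge_atTop 1] with L hL hL1
    have hL2 : (0 : ℝ) < (L : ℝ) ^ 2 := by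
      have : (1 : ℝ) ≤ L := by exact_mod_cast hL1
      positivity
    rw [sectorPressureTT'_zero, div_le_iff₀ hL2]; exact hL
  have hlo : ∀ s : ℝ, s < 2 * Real.binEntropy (n / 2) → ∀ᶠ L : ℕ in atTop, s ≤ sectorPressureTT' 0 t t' U n L := by
    intro s hs
    filter_upwards [eventually_le_log_sectorGibbsCount hn0 hn2 hs, eventually_ge_atTop 1] with L hL hL1
    have hL2 : (0 : ℝ) < (L : ℝ) ^ 2 := by
      have : (1 : ℝ) ≤ L := by exact_mod_cast hL1
      positivity
    rw [sectorPressureTT'_zero, le_div_iff₀ hL2]; exact hL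
  refine le_antisymm ?_ ?_
  · exact limsup_le_of_forall_eventually_le_add (hlo _ (sub_lt_self _ one_pos))
      fun ε hε => hup _ (lt_add_of_pos_right _ hε)
  · refine le_of_forall_sub_le fun ε hε => ?_
    exact le_limsup_of_frequently_le ((hlo _ (sub_lt_self _ hε)).frequently)
      (isBoundedUnder_of_eventually_le (hup _ (lt_add_of_pos_right _ one_pos)))

/-- **The infinite-temperature value, lower half**: `p⁻(0; t,t',U; n) = 2 H_b(n/2)` (`0 ≤ n ≤ 2`) — so at `β = 0`
the limit exists with no certificate. [cite: Israel1979, Lemma II.3.1] -/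
theorem pressureInfTT'_zero (t t' U : ℝ) {n : ℝ} (hn0 : 0 ≤ n) (hn2 : n ≤ 2) :
    pressureInfTT' 0 t t' U n = 2 * Real.binEntropy (n / 2) := by
  have hup : ∀ s : ℝ, 2 * Real.binEntropy (n / 2) < s → ∀ᶠ L : ℕ in atTop, sectorPressureTT' 0 t t' U n L ≤ s := by
    intro s hs
    filter_upwards [eventually_log_sectorGibbsCount_le hn0 hn2 hs, eventually_ge_atTop 1] with L hL hL1
    have hL2 : (0 : ℝ) < (L : ℝ) ^ 2 := by
      have : (1 : ℝ) ≤ L := by exact_mod_cast hL1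
      positivity
    rw [sectorPressureTT'_zero, div_le_iff₀ hL2]; exact hL
  have hlo : ∀ s : ℝ, s < 2 * Real.binEntropy (n / 2) → ∀ᶠ L : ℕ in atTop, s ≤ sectorPressureTT' 0 t t' U n L := by
    intro s hs
    filter_upwards [eventually_le_log_sectorGibbsCount hn0 hn2 hs, eventually_ge_atTop 1] with L hL hL1
    have hL2 : (0 : ℝ) < (L : ℝ) ^ 2 := by
      have : (1 : ℝ) ≤ L := by exact_mod_cast hL1
      positivity
    rw [sectorPressureTT'_zero, le_div_iff₀ hL2]; exact hL
  refine le_antisymm ?_ ?_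
  · refine le_of_forall_pos_le_add fun ε hε => ?_
    exact liminf_le_of_frequently_le ((hup _ (lt_add_of_pos_right _ hε)).frequently)
      (isBoundedUnder_of_eventually_ge (hlo _ (sub_lt_self _ one_pos)))
  · exact le_liminf_of_forall_eventually_sub_le (hup _ (lt_add_of_pos_right _ one_pos))
      fun ε hε => hlo _ (sub_lt_self _ hε)

end ThermodynamicLimit

/-! ### §4 Thermal energy windows of torus-limit Gibbs states as chords of the numbers -/

namespace InfVolFermionState

open ThermodynamicLimit

variable {t t' U n β : ℝ} {ω : InfVolFermionState 2} {Ls : ℕ → ℕ}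

/-- **Hot chord from the numbers.** For every torus limit `ω` of the canonical sector Gibbs states at `β` along
any `Ls → ∞` (`0 ≤ n < 2`) and every `0 < β_h < β`:
`e_{Φ(t,t',U)}(ω) ≤ (p⁺(β_h) − p⁻(β)) / (β − β_h)`. [cite: Israel1979, Lemma II.3.1] [cite: Ruelle1969, §2.5–2.6] -/
theorem IsTorusLimitOfMixture.meanEnergy_hubbardTTPrime_le_pressure_chord (hn0 : 0 ≤ n) (hn2 : n < 2)
    (h : ω.IsTorusLimitOfMixture (sectorGibbsCount n) (fun L => sectorGibbsWeightTT' β t t' U n L)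
      (fun L => sectorGibbsVectorTT' t t' U n L) Ls)
    (hLs : Tendsto Ls atTop atTop) {βh : ℝ} (hβh : 0 < βh) (hlt : βh < β) :
    ω.meanEnergy (hubbardTTPrimeFermionInteraction t t' U) 1 ≤
      (pressureSupTT' βh t t' U n - pressureInfTT' β t t' U n) / (β - βh) := by
  have hβ : 0 ≤ β := (hβh.trans hlt).le
  have hd : 0 < β - βh := sub_pos.2 hlt
  refine le_of_forall_pos_le_add fun δ hδ => ?_
  set ε := δ * (β - βh) / 2 with hε
  have hεpos : 0 < ε := by positivity
  have hℓ := eventually_sub_mul_sq_le_log_partitionFn_of_le_pressureInfTT' hβ t t' U hn0 hn2 le_rfl hLs hεpos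
  have hu := eventually_log_partitionFn_le_add_mul_sq_of_pressureSupTT'_le hβh.le t t' U hn0 hn2 le_rfl hLs hεpos
  have hch := h.meanEnergy_hubbardTTPrime_le_chord_of_sectorGibbs hn0 hn2.le hLs hβh hlt hℓ hu
  refine hch.trans (le_of_eq ?_)
  rw [hε]
  field_simp
  ring

/-- **Cold chord from the numbers.** With `ω`, `Ls`, `n` as above, `0 < β < β_c`:
`(p⁻(β) − p⁺(β_c)) / (β_c − β) ≤ e_{Φ(t,t',U)}(ω)`. [cite: Israel1979, Lemma II.3.1] [cite: Ruelle1969, §2.5–2.6] -/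
theorem IsTorusLimitOfMixture.pressure_chord_le_meanEnergy_hubbardTTPrime (hn0 : 0 ≤ n) (hn2 : n < 2)
    (h : ω.IsTorusLimitOfMixture (sectorGibbsCount n) (fun L => sectorGibbsWeightTT' β t t' U n L)
      (fun L => sectorGibbsVectorTT' t t' U n L) Ls)
    (hLs : Tendsto Ls atTop atTop) {βc : ℝ} (hβ : 0 < β) (hlt : β < βc) :
    (pressureInfTT' β t t' U n - pressureSupTT' βc t t' U n) / (βc - β) ≤
      ω.meanEnergy (hubbardTTPrimeFermionInteraction t t' U) 1 := by
  have hd : 0 < βc - β := sub_pos.2 hlt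
  refine le_of_forall_sub_le fun δ hδ => ?_
  set ε := δ * (βc - β) / 2 with hε
  have hεpos : 0 < ε := by positivity
  have hℓ := eventually_sub_mul_sq_le_log_partitionFn_of_le_pressureInfTT' hβ.le t t' U hn0 hn2 le_rfl hLs hεpos
  have hu := eventually_log_partitionFn_le_add_mul_sq_of_pressureSupTT'_le (hβ.trans hlt).le t t' U hn0 hn2
    le_rfl hLs hεpos
  have hch := h.chord_le_meanEnergy_hubbardTTPrime_of_sectorGibbs hn0 hn2.le hLs hβ hlt hℓ hu
  refine le_trans (le_of_eq ?_) hch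
  rw [hε]
  field_simp
  ring

/-- **Infinite-temperature chord from the numbers**: `e_{Φ(t,t',U)}(ω) ≤ (2 H_b(n/2) − p⁻(β)) / β` for every torus
limit at `β > 0` (`0 ≤ n < 2`). [cite: Israel1979, Lemma II.3.1] -/
theorem IsTorusLimitOfMixture.meanEnergy_hubbardTTPrime_le_binEntropy_sub_pressureInf_div (hn0 : 0 ≤ n)
    (hn2 : n < 2)
    (h : ω.IsTorusLimitOfMixture (sectorGibbsCount n) (fun L => sectorGibbsWeightTT' β t t' U n L)
      (fun L => sectorGibbsVectorTT' t t' U n L) Ls)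
    (hLs : Tendsto Ls atTop atTop) (hβ : 0 < β) :
    ω.meanEnergy (hubbardTTPrimeFermionInteraction t t' U) 1 ≤
      (2 * Real.binEntropy (n / 2) - pressureInfTT' β t t' U n) / β := by
  refine le_of_forall_pos_le_add fun δ hδ => ?_
  set ε := δ * β / 2 with hε
  have hεpos : 0 < ε := by positivity
  have hℓ := eventually_sub_mul_sq_le_log_partitionFn_of_le_pressureInfTT' hβ.le t t' U hn0 hn2 le_rfl hLs hεpos
  have hs := hLs.eventually (eventually_log_sectorGibbsCount_le hn0 hn2.le (s := 2 * Real.binEntropy (n / 2) + ε)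
    (lt_add_of_pos_right _ hεpos))
  have hch := h.meanEnergy_hubbardTTPrime_le_entropy_sub_div_of_sectorGibbs hn0 hn2.le hLs hβ hℓ hs
  refine hch.trans (le_of_eq ?_)
  rw [hε]
  field_simp
  ring

end InfVolFermionState

namespace ThermodynamicLimit

/-- **β-staircase, floor step, in numbers.** If every torus limit of the canonical sector Gibbs states at `b₀ ≥ 0`
(along every `Ls → ∞`) has thermal energy `≤ e⁺`, then for every `b₁ ≥ b₀`:
`p⁻(b₀) − (b₁ − b₀)·e⁺ ≤ p⁻(b₁)` (`0 ≤ n < 2`; the energy is antitone in `β`, so the hot-end cap prices the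
whole step). [cite: GustafsonSigal2003, §18.3] [cite: Israel1979, Lemma II.3.1] -/
theorem pressureInfTT'_sub_mul_le_pressureInfTT' (t t' U : ℝ) {n : ℝ} (hn0 : 0 ≤ n) (hn2 : n < 2) {b₀ b₁ : ℝ}
    (hb₀ : 0 ≤ b₀) (hb : b₀ ≤ b₁) {ecap : ℝ}
    (hcap : ∀ (ω : InfVolFermionState 2) (Ls : ℕ → ℕ), Tendsto Ls atTop atTop →
      ω.IsTorusLimitOfMixture (sectorGibbsCount n) (fun L => sectorGibbsWeightTT' b₀ t t' U n L)
        (fun L => sectorGibbsVectorTT' t t' U n L) Ls →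
      ω.meanEnergy (hubbardTTPrimeFermionInteraction t t' U) 1 ≤ ecap) :
    pressureInfTT' b₀ t t' U n - (b₁ - b₀) * ecap ≤ pressureInfTT' b₁ t t' U n := by
  have hbmono : Monotone (fun i : ℕ => if i = 0 then b₀ else b₁) := by
    intro i j hij
    dsimp only
    split_ifs with hi hj hj
    · exact le_rfl
    · exact hb
    · omega
    · exact le_rfl
  refine (le_pressureInfTT'_iff (hb₀.trans hb) t t' U hn0 hn2).2 fun ε hε => ?_
  have hst := eventually_pressureFloor_staircase t t' U hn0 hn2.le tendsto_id
    (b := fun i : ℕ => if i = 0 then b₀ else b₁) hb₀ hbmono 1 (ecap := fun _ => ecap)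
    (fun i hi ω Ls' hLs' hω => by
      obtain rfl : i = 0 := by omega
      exact hcap ω Ls' hLs' hω)
    (W₀ := pressureInfTT' b₀ t t' U n)
    (fun ε' hε' => eventually_sub_mul_sq_le_log_partitionFn_of_le_pressureInfTT' hb₀ t t' U hn0 hn2
      (le_refl (pressureInfTT' b₀ t t' U n)) tendsto_id hε') hε
  filter_upwards [hst] with L hL
  convert hL using 2 <;> first | rfl | simp

/-- **β-staircase, ceiling step, in numbers.** If every torus limit of the canonical sector Gibbs states at `b₁`
has thermal energy `≥ e⁻`, then for every `0 ≤ b₀ ≤ b₁`: `p⁺(b₁) ≤ p⁺(b₀) − (b₁ − b₀)·e⁻` (`0 ≤ n < 2`).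
[cite: GustafsonSigal2003, §18.3] [cite: Israel1979, Lemma II.3.1] -/
theorem pressureSupTT'_le_pressureSupTT'_sub_mul (t t' U : ℝ) {n : ℝ} (hn0 : 0 ≤ n) (hn2 : n < 2) {b₀ b₁ : ℝ}
    (hb₀ : 0 ≤ b₀) (hb : b₀ ≤ b₁) {efl : ℝ}
    (hfloor : ∀ (ω : InfVolFermionState 2) (Ls : ℕ → ℕ), Tendsto Ls atTop atTop →
      ω.IsTorusLimitOfMixture (sectorGibbsCount n) (fun L => sectorGibbsWeightTT' b₁ t t' U n L)
        (fun L => sectorGibbsVectorTT' t t' U n L) Ls →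
      efl ≤ ω.meanEnergy (hubbardTTPrimeFermionInteraction t t' U) 1) :
    pressureSupTT' b₁ t t' U n ≤ pressureSupTT' b₀ t t' U n - (b₁ - b₀) * efl := by
  have hbmono : Monotone (fun i : ℕ => if i = 0 then b₀ else b₁) := by
    intro i j hij
    dsimp only
    split_ifs with hi hj hj
    · exact le_rfl
    · exact hb
    · omega
    · exact le_rfl
  refine (pressureSupTT'_le_iff (hb₀.trans hb) t t' U hn0 hn2).2 fun ε hε => ?_
  have hst := eventually_pressureCeiling_staircase t t' U hn0 hn2.le tendsto_id
    (b := fun i : ℕ => if i = 0 then b₀ else b₁) hb₀ hbmono 1 (efl := fun _ => efl)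
    (fun i hi ω Ls' hLs' hω => by
      obtain rfl : i = 0 := by omega
      exact hfloor ω Ls' hLs' hω)
    (u₀ := pressureSupTT' b₀ t t' U n)
    (fun ε' hε' => eventually_log_partitionFn_le_add_mul_sq_of_pressureSupTT'_le hb₀ t t' U hn0 hn2
      (le_refl (pressureSupTT' b₀ t t' U n)) tendsto_id hε') hε
  filter_upwards [hst] with L hL
  convert hL using 2 <;> first | rfl | simp

/-! ### §5 Scale covariance, joint convexity in the β-scaled couplings, monotonicity, Lipschitz -/

/-- **Scale covariance at finite volume**: `p_L(β; ct, ct', cU; n) = p_L(βc; t, t', U; n)`.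
[cite: Ruelle1969, §3.3] -/
theorem sectorPressureTT'_scale (β c t t' U n : ℝ) (L : ℕ) :
    sectorPressureTT' β (c * t) (c * t') (c * U) n L = sectorPressureTT' (β * c) t t' U n L := by
  rw [sectorPressureTT', sectorPressureTT', partitionFn_sectorHamiltonianTT'_scale]

/-- **Scale covariance of `p⁺`**: `p⁺(β; ct, ct', cU) = p⁺(βc; t, t', U)`. [cite: Ruelle1969, §3.3] -/
theorem pressureSupTT'_scale (β c t t' U n : ℝ) :
    pressureSupTT' β (c * t) (c * t') (c * U) n = pressureSupTT' (β * c) t t' U n := by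
  simp only [pressureSupTT', sectorPressureTT'_scale]

/-- **Scale covariance of `p⁻`**: `p⁻(β; ct, ct', cU) = p⁻(βc; t, t', U)`. [cite: Ruelle1969, §3.3] -/
theorem pressureInfTT'_scale (β c t t' U n : ℝ) :
    pressureInfTT' β (c * t) (c * t') (c * U) n = pressureInfTT' (β * c) t t' U n := by
  simp only [pressureInfTT', sectorPressureTT'_scale]

/-- **The β-scaled form**: `p⁺(β; t,t',U) = p⁺(1; βt, βt', βU)` — the pressure is a function of the β-scaled
couplings only. [cite: Ruelle1969, §3.3] -/
theorem pressureSupTT'_eq_one (β t t' U n : ℝ) :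
    pressureSupTT' β t t' U n = pressureSupTT' 1 (β * t) (β * t') (β * U) n := by
  rw [pressureSupTT'_scale, one_mul]

/-- The β-scaled form of `p⁻`: `p⁻(β; t,t',U) = p⁻(1; βt, βt', βU)`. [cite: Ruelle1969, §3.3] -/
theorem pressureInfTT'_eq_one (β t t' U n : ℝ) :
    pressureInfTT' β t t' U n = pressureInfTT' 1 (β * t) (β * t') (β * U) n := by
  rw [pressureInfTT'_scale, one_mul]

/-- **Jensen CAP over a TEMPERATURE × COUPLING cell.** Let `0 ≤ n < 2`, weights `w_k ≥ 0` summing to `1` on a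
finite set `S`, anchors `(β_k ≥ 0, q_k = (t_k, t'_k, U_k))` and a target `(β ≥ 0, q)` with
`β • q = Σ_k w_k • (β_k • q_k)` (barycentre in the β-SCALED couplings). If `p⁺(β_k; q_k) ≤ u_k` for all `k`, then
`p⁺(β; q) ≤ Σ_k w_k u_k` — certified pressure ceilings at the corners of a temperature × coupling cell cap the
pressure at every point of the cell. [cite: Israel1979, Thm. I.2.4] [cite: Lieb1973, §V (5.2)–(5.4)] -/
theorem pressureSupTT'_le_sum {n : ℝ} (hn0 : 0 ≤ n) (hn2 : n < 2) {κ : Type*} (S : Finset κ) (w : κ → ℝ)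
    (βk : κ → ℝ) (qk : κ → ℝ × ℝ × ℝ) (u : κ → ℝ) (hw : ∀ k ∈ S, 0 ≤ w k) (hw1 : ∑ k ∈ S, w k = 1)
    (hβk : ∀ k ∈ S, 0 ≤ βk k) {β : ℝ} (hβ : 0 ≤ β) {q : ℝ × ℝ × ℝ} (hc : β • q = ∑ k ∈ S, w k • (βk k • qk k))
    (hu : ∀ k ∈ S, pressureSupTT' (βk k) (qk k).1 (qk k).2.1 (qk k).2.2 n ≤ u k) :
    pressureSupTT' β q.1 q.2.1 q.2.2 n ≤ ∑ k ∈ S, w k * u k := by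
  refine (pressureSupTT'_le_iff hβ q.1 q.2.1 q.2.2 hn0 hn2).2 fun ε hε => ?_
  have hall : ∀ᶠ L : ℕ in atTop, ∀ k ∈ S,
      Real.log (partitionFn (βk k) (sectorHamiltonianTT' (qk k).1 (qk k).2.1 (qk k).2.2 n L)).re ≤
        (u k + ε) * (L : ℝ) ^ 2 := by
    rw [eventually_all_finset]
    intro k hk
    exact (pressureSupTT'_le_iff (hβk k hk) (qk k).1 (qk k).2.1 (qk k).2.2 hn0 hn2).1 (hu k hk) ε hε
  filter_upwards [hall] with L hL
  have hJ := log_partitionFn_sectorHamiltonianTT'_le_sum_temperature (L := L) hn0 hn2.le S w βk qk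
    (fun k => (u k + ε) * (L : ℝ) ^ 2) hw hw1 hc hL
  refine hJ.trans (le_of_eq ?_)
  calc ∑ k ∈ S, w k * ((u k + ε) * (L : ℝ) ^ 2)
      = ∑ k ∈ S, (w k * u k * (L : ℝ) ^ 2 + ε * (L : ℝ) ^ 2 * w k) :=
        Finset.sum_congr rfl fun k _ => by ring
    _ = (∑ k ∈ S, w k * u k) * (L : ℝ) ^ 2 + ε * (L : ℝ) ^ 2 * ∑ k ∈ S, w k := by
        rw [Finset.sum_add_distrib, Finset.sum_mul, Finset.mul_sum]
    _ = (∑ k ∈ S, w k * u k + ε) * (L : ℝ) ^ 2 := by rw [hw1]; ring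

/-- **JOINT CONVEXITY OF `p⁺` IN THE β-SCALED COUPLINGS**: for `0 ≤ n < 2`,
`(λ₁, λ₂, λ₃) ↦ p⁺(1; λ₁, λ₂, λ₃; n)` is convex on `ℝ³` (`limsup` of the convex finite-volume `log Z`'s); with
`p⁺(β; t,t',U) = p⁺(1; βt, βt', βU)` this is the joint convexity of the thermal pressure in `(βt, βt', βU)`.
[cite: Israel1979, Thm. I.2.4] -/
theorem convexOn_pressureSupTT'_one {n : ℝ} (hn0 : 0 ≤ n) (hn2 : n < 2) :
    ConvexOn ℝ Set.univ (fun q : ℝ × ℝ × ℝ => pressureSupTT' 1 q.1 q.2.1 q.2.2 n) := by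
  refine ⟨convex_univ, fun x _ y _ a b ha hb hab => ?_⟩
  have h := pressureSupTT'_le_sum hn0 hn2 (Finset.univ : Finset Bool) (fun k => if k then a else b)
    (fun _ => 1) (fun k => if k then x else y)
    (fun k => if k then pressureSupTT' 1 x.1 x.2.1 x.2.2 n else pressureSupTT' 1 y.1 y.2.1 y.2.2 n)
    (fun k _ => by cases k <;> simp [ha, hb]) (by simp [hab]) (fun _ _ => zero_le_one) zero_le_one
    (q := a • x + b • y) (by simp [one_smul]) (fun k _ => by cases k <;> simp)
  simpa [smul_eq_mul] using h

/-- **Convexity in `β` at fixed couplings**: `β ↦ p⁺(β; t,t',U; n)` is convex on `[0, ∞)` (`0 ≤ n < 2`).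
[cite: GustafsonSigal2003, §18.3] -/
theorem convexOn_pressureSupTT'_beta (t t' U : ℝ) {n : ℝ} (hn0 : 0 ≤ n) (hn2 : n < 2) :
    ConvexOn ℝ (Set.Ici 0) (fun β : ℝ => pressureSupTT' β t t' U n) := by
  have h := ((convexOn_pressureSupTT'_one hn0 hn2).comp_linearMap
    ((LinearMap.id : ℝ →ₗ[ℝ] ℝ).smulRight ((t, t', U) : ℝ × ℝ × ℝ))).subset (Set.subset_univ _) (convex_Ici 0)
  refine h.congr fun β _ => ?_
  simp only [Function.comp_apply, LinearMap.smulRight_apply, LinearMap.id_apply, Prod.smul_mk, smul_eq_mul]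
  rw [pressureSupTT'_eq_one β t t' U n]

/-- **`p⁺` is antitone in `U`** (`β ≥ 0`, `0 ≤ n < 2`): `U₁ ≤ U₂ ⇒ p⁺(U₂) ≤ p⁺(U₁)` — a pressure ceiling
certified at `U₁` holds at every `U ≥ U₁`. [cite: Israel1979, Thm. I.3.4] -/
theorem pressureSupTT'_anti_U {β : ℝ} (hβ : 0 ≤ β) (t s : ℝ) {n : ℝ} (hn0 : 0 ≤ n) (hn2 : n < 2) {U₁ U₂ : ℝ}
    (hU : U₁ ≤ U₂) : pressureSupTT' β t s U₂ n ≤ pressureSupTT' β t s U₁ n := by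
  refine limsup_le_limsup ?_ (isBoundedUnder_ge_sectorPressureTT' hβ t s U₂ hn0 hn2).isCoboundedUnder_le
    (isBoundedUnder_le_sectorPressureTT' hβ t s U₁ hn0 hn2)
  filter_upwards [eventually_ge_atTop 1] with L hL1
  haveI : NeZero L := ⟨by omega⟩
  exact div_le_div_of_nonneg_right (log_partitionFn_sectorHamiltonianTT'_anti_U hn0 hn2.le L t s hβ hU)
    (sq_nonneg _)

/-- **`p⁻` is antitone in `U`** (`β ≥ 0`, `0 ≤ n < 2`): `U₁ ≤ U₂ ⇒ p⁻(U₂) ≤ p⁻(U₁)` — a pressure floor certified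
at `U₂` holds at every `U ≤ U₂`. [cite: Israel1979, Thm. I.3.4] -/
theorem pressureInfTT'_anti_U {β : ℝ} (hβ : 0 ≤ β) (t s : ℝ) {n : ℝ} (hn0 : 0 ≤ n) (hn2 : n < 2) {U₁ U₂ : ℝ}
    (hU : U₁ ≤ U₂) : pressureInfTT' β t s U₂ n ≤ pressureInfTT' β t s U₁ n := by
  refine liminf_le_liminf ?_ (isBoundedUnder_ge_sectorPressureTT' hβ t s U₂ hn0 hn2)
    (isBoundedUnder_le_sectorPressureTT' hβ t s U₁ hn0 hn2).isCoboundedUnder_ge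
  filter_upwards [eventually_ge_atTop 1] with L hL1
  haveI : NeZero L := ⟨by omega⟩
  exact div_le_div_of_nonneg_right (log_partitionFn_sectorHamiltonianTT'_anti_U hn0 hn2.le L t s hβ hU)
    (sq_nonneg _)

/-- Finite-volume `U`-Lipschitz per site: `|p_L(U₁) − p_L(U₂)| ≤ β (n/2) |U₁ − U₂|` (`β ≥ 0`, `0 ≤ n ≤ 2`, `L ≥ 1`).
[cite: Lieb1973, §V (5.2)–(5.4)] -/
theorem abs_sectorPressureTT'_sub_le_U {β : ℝ} (hβ : 0 ≤ β) (t s : ℝ) {n : ℝ} (hn0 : 0 ≤ n) (hn2 : n ≤ 2)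
    (L : ℕ) [NeZero L] (U₁ U₂ : ℝ) :
    |sectorPressureTT' β t s U₁ n L - sectorPressureTT' β t s U₂ n L| ≤ β * (n / 2) * |U₁ - U₂| := by
  have hL2 : (0 : ℝ) < (L : ℝ) ^ 2 := by
    have : (1 : ℝ) ≤ L := by exact_mod_cast NeZero.one_le
    positivity
  have h := abs_log_partitionFn_sectorHamiltonianTT'_sub_le_U hn0 hn2 L t s hβ U₁ U₂
  rw [sectorPressureTT', sectorPressureTT', ← sub_div, abs_div, abs_of_pos hL2, div_le_iff₀ hL2]
  calc _ ≤ β * (n / 2 * (L : ℝ) ^ 2) * |U₁ - U₂| := h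
    _ = β * (n / 2) * |U₁ - U₂| * (L : ℝ) ^ 2 := by ring

/-- **`U`-Lipschitz of `p⁺`**: `p⁺(U₁) ≤ p⁺(U₂) + β (n/2) |U₁ − U₂|` (`β ≥ 0`, `0 ≤ n < 2`).
[cite: Lieb1973, §V (5.2)–(5.4)] -/
theorem pressureSupTT'_le_add_U {β : ℝ} (hβ : 0 ≤ β) (t s : ℝ) {n : ℝ} (hn0 : 0 ≤ n) (hn2 : n < 2)
    (U₁ U₂ : ℝ) : pressureSupTT' β t s U₁ n ≤ pressureSupTT' β t s U₂ n + β * (n / 2) * |U₁ - U₂| := by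
  obtain ⟨c, hc⟩ := exists_eventually_le_sectorPressureTT' hβ t s U₁ hn0 hn2
  obtain ⟨C, hC⟩ := exists_eventually_sectorPressureTT'_le hβ t s U₂ hn0 hn2
  refine limsup_le_of_forall_eventually_le_add hc fun ε hε => ?_
  filter_upwards [eventually_lt_add_of_limsup_le hC le_rfl hε, eventually_ge_atTop 1] with L hL hL1
  haveI : NeZero L := ⟨by omega⟩
  have h := (abs_le.1 (abs_sectorPressureTT'_sub_le_U hβ t s hn0 hn2.le L U₁ U₂)).2
  change sectorPressureTT' β t s U₂ n L < pressureSupTT' β t s U₂ n + ε at hL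
  linarith

/-- **`U`-Lipschitz of `p⁻`**: `p⁻(U₂) − β (n/2) |U₁ − U₂| ≤ p⁻(U₁)` (`β ≥ 0`, `0 ≤ n < 2`).
[cite: Lieb1973, §V (5.2)–(5.4)] -/
theorem pressureInfTT'_sub_le_U {β : ℝ} (hβ : 0 ≤ β) (t s : ℝ) {n : ℝ} (hn0 : 0 ≤ n) (hn2 : n < 2)
    (U₁ U₂ : ℝ) : pressureInfTT' β t s U₂ n - β * (n / 2) * |U₁ - U₂| ≤ pressureInfTT' β t s U₁ n := by
  obtain ⟨c, hc⟩ := exists_eventually_le_sectorPressureTT' hβ t s U₂ hn0 hn2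
  obtain ⟨C, hC⟩ := exists_eventually_sectorPressureTT'_le hβ t s U₁ hn0 hn2
  refine le_liminf_of_forall_eventually_sub_le hC fun ε hε => ?_
  filter_upwards [eventually_sub_lt_of_le_liminf hc le_rfl hε, eventually_ge_atTop 1] with L hL hL1
  haveI : NeZero L := ⟨by omega⟩
  have h := (abs_le.1 (abs_sectorPressureTT'_sub_le_U hβ t s hn0 hn2.le L U₁ U₂)).1
  change pressureInfTT' β t s U₂ n - ε < sectorPressureTT' β t s U₂ n L at hL
  linarith

/-- **`U`-Lipschitz, two-sided**: `|p⁺(U₁) − p⁺(U₂)| ≤ β (n/2) |U₁ − U₂|`. [cite: Lieb1973, §V (5.2)–(5.4)] -/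
theorem abs_pressureSupTT'_sub_le_U {β : ℝ} (hβ : 0 ≤ β) (t s : ℝ) {n : ℝ} (hn0 : 0 ≤ n) (hn2 : n < 2)
    (U₁ U₂ : ℝ) : |pressureSupTT' β t s U₁ n - pressureSupTT' β t s U₂ n| ≤ β * (n / 2) * |U₁ - U₂| := by
  have h1 := pressureSupTT'_le_add_U hβ t s hn0 hn2 U₁ U₂
  have h2 := pressureSupTT'_le_add_U hβ t s hn0 hn2 U₂ U₁
  rw [abs_sub_comm U₂ U₁] at h2
  rw [abs_le]; constructor <;> linarith

/-- **`U`-Lipschitz of `p⁻`, two-sided**: `|p⁻(U₁) − p⁻(U₂)| ≤ β (n/2) |U₁ − U₂|`. [cite: Lieb1973, §V (5.2)–(5.4)] -/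
theorem abs_pressureInfTT'_sub_le_U {β : ℝ} (hβ : 0 ≤ β) (t s : ℝ) {n : ℝ} (hn0 : 0 ≤ n) (hn2 : n < 2)
    (U₁ U₂ : ℝ) : |pressureInfTT' β t s U₁ n - pressureInfTT' β t s U₂ n| ≤ β * (n / 2) * |U₁ - U₂| := by
  have h1 := pressureInfTT'_sub_le_U hβ t s hn0 hn2 U₁ U₂
  have h2 := pressureInfTT'_sub_le_U hβ t s hn0 hn2 U₂ U₁
  rw [abs_sub_comm U₂ U₁] at h2
  rw [abs_le]; constructor <;> linarith

/-- **`t'`-Lipschitz of `p⁺`**: `p⁺(β; t, s₁, U) ≤ p⁺(β; t, s₂, U) + 4βn |s₁ − s₂|` (`β ≥ 0`, `0 ≤ n < 2`; the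
finite-volume constant `4β · rectN n L` per volume tends to `4βn`). [cite: Lieb1973, §V (5.2)–(5.4)]
[cite: LiebLoss1993, §8, Theorem 8.2] -/
theorem pressureSupTT'_le_add_tPrime {β : ℝ} (hβ : 0 ≤ β) (t U : ℝ) {n : ℝ} (hn0 : 0 ≤ n) (hn2 : n < 2)
    (s₁ s₂ : ℝ) : pressureSupTT' β t s₁ U n ≤ pressureSupTT' β t s₂ U n + 4 * β * n * |s₁ - s₂| := by
  obtain ⟨c, hc⟩ := exists_eventually_le_sectorPressureTT' hβ t s₁ U hn0 hn2
  obtain ⟨C, hC⟩ := exists_eventually_sectorPressureTT'_le hβ t s₂ U hn0 hn2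
  refine limsup_le_of_forall_eventually_le_add hc fun ε hε => ?_
  have hε2 : 0 < ε / 2 := by positivity
  -- `rectN n L / L² → n`, so eventually `4β (rectN/L²) |Δs| ≤ 4βn|Δs| + ε/2`
  have hK : Tendsto (fun L : ℕ => 4 * β * ((rectN n L : ℝ) / (L : ℝ) ^ 2) * |s₁ - s₂|) atTop
      (𝓝 (4 * β * n * |s₁ - s₂|)) :=
    ((tendsto_rectN_div_sq hn0).const_mul (4 * β)).mul_const _
  have hK' : ∀ᶠ L : ℕ in atTop, 4 * β * ((rectN n L : ℝ) / (L : ℝ) ^ 2) * |s₁ - s₂| < 4 * β * n * |s₁ - s₂| + ε / 2 :=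
    hK.eventually (Iio_mem_nhds (by linarith))
  filter_upwards [eventually_lt_add_of_limsup_le hC le_rfl hε2, hK', eventually_ge_atTop 3] with L hL hKL hL3
  haveI : NeZero L := ⟨by omega⟩
  have hL2 : (0 : ℝ) < (L : ℝ) ^ 2 := by positivity
  have hfin := (abs_le.1 (abs_log_partitionFn_sector_sub_le_tPrime hn0 hn2.le hL3 t U hβ s₁ s₂)).2
  have hfin' : sectorPressureTT' β t s₁ U n L - sectorPressureTT' β t s₂ U n L ≤
      4 * β * ((rectN n L : ℝ) / (L : ℝ) ^ 2) * |s₁ - s₂| := by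
    rw [sectorPressureTT', sectorPressureTT', ← sub_div, div_le_iff₀ hL2]
    calc _ ≤ 4 * β * rectN n L * |s₁ - s₂| := by linarith
      _ = 4 * β * ((rectN n L : ℝ) / (L : ℝ) ^ 2) * |s₁ - s₂| * (L : ℝ) ^ 2 := by
          field_simp
  change sectorPressureTT' β t s₂ U n L < pressureSupTT' β t s₂ U n + ε / 2 at hL
  linarith

/-- **`t'`-Lipschitz of `p⁻`**: `p⁻(β; t, s₂, U) − 4βn |s₁ − s₂| ≤ p⁻(β; t, s₁, U)` (`β ≥ 0`, `0 ≤ n < 2`).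
[cite: Lieb1973, §V (5.2)–(5.4)] [cite: LiebLoss1993, §8, Theorem 8.2] -/
theorem pressureInfTT'_sub_le_tPrime {β : ℝ} (hβ : 0 ≤ β) (t U : ℝ) {n : ℝ} (hn0 : 0 ≤ n) (hn2 : n < 2)
    (s₁ s₂ : ℝ) : pressureInfTT' β t s₂ U n - 4 * β * n * |s₁ - s₂| ≤ pressureInfTT' β t s₁ U n := by
  obtain ⟨c, hc⟩ := exists_eventually_le_sectorPressureTT' hβ t s₂ U hn0 hn2
  obtain ⟨C, hC⟩ := exists_eventually_sectorPressureTT'_le hβ t s₁ U hn0 hn2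
  refine le_liminf_of_forall_eventually_sub_le hC fun ε hε => ?_
  have hε2 : 0 < ε / 2 := by positivity
  have hK : Tendsto (fun L : ℕ => 4 * β * ((rectN n L : ℝ) / (L : ℝ) ^ 2) * |s₁ - s₂|) atTop
      (𝓝 (4 * β * n * |s₁ - s₂|)) :=
    ((tendsto_rectN_div_sq hn0).const_mul (4 * β)).mul_const _
  have hK' : ∀ᶠ L : ℕ in atTop, 4 * β * ((rectN n L : ℝ) / (L : ℝ) ^ 2) * |s₁ - s₂| < 4 * β * n * |s₁ - s₂| + ε / 2 :=
    hK.eventually (Iio_mem_nhds (by linarith))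
  filter_upwards [eventually_sub_lt_of_le_liminf hc le_rfl hε2, hK', eventually_ge_atTop 3] with L hL hKL hL3
  haveI : NeZero L := ⟨by omega⟩
  have hL2 : (0 : ℝ) < (L : ℝ) ^ 2 := by positivity
  have hfin := (abs_le.1 (abs_log_partitionFn_sector_sub_le_tPrime hn0 hn2.le hL3 t U hβ s₁ s₂)).1
  have hfin' : -(4 * β * ((rectN n L : ℝ) / (L : ℝ) ^ 2) * |s₁ - s₂|) ≤
      sectorPressureTT' β t s₁ U n L - sectorPressureTT' β t s₂ U n L := by
    rw [sectorPressureTT', sectorPressureTT', ← sub_div, le_div_iff₀ hL2]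
    calc -(4 * β * ((rectN n L : ℝ) / (L : ℝ) ^ 2) * |s₁ - s₂|) * (L : ℝ) ^ 2
        = -(4 * β * rectN n L * |s₁ - s₂|) := by field_simp
      _ ≤ _ := by linarith
  change pressureInfTT' β t s₂ U n - ε / 2 < sectorPressureTT' β t s₂ U n L at hL
  linarith

/-- **`t'`-Lipschitz, two-sided**: `|p⁺(β;t,s₁,U) − p⁺(β;t,s₂,U)| ≤ 4βn |s₁ − s₂|`. [cite: Lieb1973, §V (5.2)–(5.4)] -/
theorem abs_pressureSupTT'_sub_le_tPrime {β : ℝ} (hβ : 0 ≤ β) (t U : ℝ) {n : ℝ} (hn0 : 0 ≤ n) (hn2 : n < 2)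
    (s₁ s₂ : ℝ) : |pressureSupTT' β t s₁ U n - pressureSupTT' β t s₂ U n| ≤ 4 * β * n * |s₁ - s₂| := by
  have h1 := pressureSupTT'_le_add_tPrime hβ t U hn0 hn2 s₁ s₂
  have h2 := pressureSupTT'_le_add_tPrime hβ t U hn0 hn2 s₂ s₁
  rw [abs_sub_comm s₂ s₁] at h2
  rw [abs_le]; constructor <;> linarith

/-- **`t'`-Lipschitz of `p⁻`, two-sided**: `|p⁻(β;t,s₁,U) − p⁻(β;t,s₂,U)| ≤ 4βn |s₁ − s₂|`.
[cite: Lieb1973, §V (5.2)–(5.4)] -/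
theorem abs_pressureInfTT'_sub_le_tPrime {β : ℝ} (hβ : 0 ≤ β) (t U : ℝ) {n : ℝ} (hn0 : 0 ≤ n) (hn2 : n < 2)
    (s₁ s₂ : ℝ) : |pressureInfTT' β t s₁ U n - pressureInfTT' β t s₂ U n| ≤ 4 * β * n * |s₁ - s₂| := by
  have h1 := pressureInfTT'_sub_le_tPrime hβ t U hn0 hn2 s₁ s₂
  have h2 := pressureInfTT'_sub_le_tPrime hβ t U hn0 hn2 s₂ s₁
  rw [abs_sub_comm s₂ s₁] at h2
  rw [abs_le]; constructor <;> linarith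

end ThermodynamicLimit

end Literature.MathematicalPhysics.QuantumLattice
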